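import Literature.NumberTheory.EllipticCurves.QuadraticTwist
import Literature.NumberTheory.EllipticCurves.Tamagawa
import Literature.NumberTheory.DiophantineGeometry.Conductor
import HarnessLib

/-!
# Barrios–Roy–Sahajpal–Tallana–Tobin–Wiersema 2025, Thm. 5.1 (rows `R = I₀`): the local Tamagawa
# number at `2` of a quadratic twist of an elliptic curve over `ℚ` with GOOD reduction at `2`
# lies in `{1, 2, 4}`

HONEST FRAMING (cell `b2b-bsdres`, team `x11b3`, run/shared/lean/b2b/bsd-rank1-residual/): the cell
deletes the COMBINATION-SHAPED residual classes of the BSD formula in analytic rank `≤ 1` from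
PUBLISHED theorems only and TYPES the construction-shaped ones; this is not "finishing BSD". This
file vendors ONE published theorem as a named fact (`def … : Prop`, nothing asserted; D-0014), in
the tree's vocabulary (`WeierstrassCurve.quadraticTwist`, `HasGoodReductionAtPrime`,
`localTamagawaNumber` — the latter computed on the `ℤ₂`-minimal model, hence model-independent,
`localTamagawaNumber_variableChange_holds`). Consumer: the team's sub-target S2b (x11b3-p8,
`Summits/…/X11b/Three/UpperShimuraOdd.lean`, binder `h2tw` "E good at `2`, `2 ∣ d_K` ⇒
`p ∤ c₂(E^{d_K})`" of `missingUpperBoundAt_of_ram_of_not_alpha_of_shape_GZR_odd`): for an odd prime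
`p`, `c₂ ∈ {1,2,4}` gives `p ∤ c₂` (team files `cells/x11b3/OWNERS.md`, LEAD DEAL #3 / A3.1).

Source (read 2026-08-21, held text `paper:arxiv-2501.03209` = arXiv:2501.03209, pages p0003,
p0015–p0016): A. J. Barrios, M. Roy, N. Sahajpal, D. Tallana, B. Tobin, H. Wiersema, *Local data
of elliptic curves under quadratic twist*, Res. Number Theory **11** (2025), no. 3,
doi:10.1007/s40993-025-00650-w [BarriosEtAl2025] — PUBLISHED (zbMATH / Crossref record; the table
and theorem numbering below is that of the arXiv text). Verbatim:

> Theorem 5.1. Let $E/\mathbb{Q}_{2}$ be an elliptic curve given by a normal model. For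
> $d\in\mathbb{Q}_{2}$ with $v(d)=0$ (resp. $1$), let $E^{d}$ denote the quadratic twist of $E$ by
> $d$. Then, Table (tab:localdata-dodd) (resp. (tab:localdata-deven)) gives necessary and
> sufficient conditions on the Weierstrass coefficients $a_{i}$ of $E$ to determine the
> Kodaira-Néron types of $E$ and $E^{d}$. Additional conditions are also provided to determine
> the local Tamagawa numbers $c$ and $c^{d}$ … [p0015 L22–L24]

Rows `R = I₀` (good reduction) of the two tables, columns `R`, conditions, `R^d`, `(δ,δ^d)`,
`(f,f^d)`, additional conditions, `(c,c^d)`: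

> `v(d) = 0` [p0015 L35–L46]: I₀ · d ≡ 1 mod 4 · I₀ · (0,0) · (0,0) · (1,1);
>   d ≡ 3 mod 4, v(a₁) = 0 · I₄* · (0,12) · (0,4) · a₆ ≡ 1,2 mod 4: (1,2); a₆ ≡ 0,3 mod 4: (1,4);
>   d ≡ 3 mod 4, v(a₁) ≥ 1 · II* · (0,12) · (0,4) · (1,1).
> `v(d) = 1` [p0016 L124–L133]: I₀ · v(a₁) = 0, v(a₆) = 0 · I₈* · (0,18) · (0,6) · v(P_{R,1}) = 4:
>   (1,2); v(P_{R,1}) ≥ 5: (1,4); v(a₁) = 0, v(a₆) ≥ 1 · I₈* · (0,18) · (0,6) · v(P_{R,2}) = 4: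
>   (1,2); ≥ 5: (1,4); v(a₁) ≥ 1 · II · (0,6) · (0,6) · (1,1).

So for `E/ℚ₂` with good reduction (a normal model exists for every `E`: "Proposition
(lem:pnormal)" = Prop. 1 of the introduction, p0003 L12) and `d ∈ ℚ₂` with `v(d) ∈ {0,1}`: `c₂(E^d) ∈ {1,2,4}` (and
the Kodaira type of `E^d` is `I₀`, `I₄*`, `II*`, `I₈*` or `II`). An arbitrary `d ∈ ℚ^×` is `u²·d'` in
`ℚ₂` with `v(d') ∈ {0,1}`, the quadratic twist depends only on `d` modulo squares, and `c₂` is a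
`ℚ₂`-isomorphism invariant — whence the statement below for every `d ≠ 0` and every model `Wd`
of the twist over `ℚ` (the tree's `W.quadraticTwist d = ⟨0, d b₂/4, 0, d² b₄/2, d³ b₆/4⟩` is the
paper's model (5.1) `y² = x³ + d(a₁²+4a₂)x² + d²(8a₁a₃+16a₄)x + d³(16a₃²+64a₆)` rescaled by
`u = 1/2`). EVIDENCE (not an input): the team's two census runs (x11b3-p4 j119744, 398 072 twists;
x11b3-p8 j120590, 240 400 twists; `E` good at `2`, `4 ∣ d`): Kodaira types II/II*/I₄*/I₈* and
`c₂ ∈ {1,2,4}` only. The paper CORRECTS S. Comalada, J. Number Theory 49 (1994) at residue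
characteristic `2` (p0004 L3); Comalada is not cited here.

What is NOT here: the other rows of the tables (`E` of bad reduction at `2`), the Kodaira types,
conductor exponents and discriminant valuations of the twist (not needed by the consumer), the
odd-residue-characteristic theorem ("Theorem (tamanot2)" of the introduction; the tree has its own
odd-`p` twist bookkeeping, `Summits/…/Additive/RamifiedTwistTamagawa.lean`).
-/

namespace Literature.NumberTheory.EllipticCurves.BarriosEtAl2025

/-- **Barrios–Roy–Sahajpal–Tallana–Tobin–Wiersema 2025, Thm. 5.1, rows `R = I₀` of Tables
(tab:localdata-dodd)/(tab:localdata-deven)** (Res. Number Theory 11 (2025), no. 3; arXiv:2501.03209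
pp. 15–16): if `E/ℚ` has GOOD reduction at `2`, then for every `d ∈ ℚ^×` the local Tamagawa number
at `2` of the quadratic twist `E^d` is `1`, `2` or `4` — `c₂(E^d) = 1` if `d` is a `2`-adic unit
`≡ 1 mod 4` (type I₀) or the twist has type II*/II, and `c₂(E^d) ∈ {2, 4}` in the types I₄*
(`d ≡ 3 mod 4`, `v(a₁) = 0`) and I₈* (`v(d) = 1`, `v(a₁) = 0`). Stated for every model `Wd` over `ℚ`
of the twist (`Cd • W.quadraticTwist d = Wd`; `localTamagawaNumber` is computed on the `ℤ₂`-minimal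
model, so the value does not depend on the model) and every `d ≠ 0` (the twist depends on `d`
modulo squares; reduce to `v₂(d) ∈ {0,1}`). A named fact (`Prop`, nothing asserted); consumers take
`(h : localTamagawaNumber_quadraticTwist_two_mem_of_goodReduction)`.
[cite: BarriosEtAl2025, Thm. 5.1 with Tables tab:localdata-dodd / tab:localdata-deven, rows R = I₀ (arXiv:2501.03209 pp. 15–16)] -/
def localTamagawaNumber_quadraticTwist_two_mem_of_goodReduction : Prop :=
  ∀ (W : WeierstrassCurve ℚ) [W.IsElliptic], W.HasGoodReductionAtPrime 2 →
    ∀ (d : ℚ), d ≠ 0 →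
      ∀ (Wd : WeierstrassCurve ℚ) [Wd.IsElliptic] (Cd : WeierstrassCurve.VariableChange ℚ),
        Cd • W.quadraticTwist d = Wd →
          (Wd.baseChange ℚ_[2]).localTamagawaNumber ℤ_[2] ∈ ({1, 2, 4} : Set ℕ)

/-! ### Conductor exponents of the twist for `E` SEMISTABLE at `2` (rows `R = I₀`, `I_{n>0}`; appended
2026-08-27, cell `pub/bsd-f2-manin`, typer seat)

The `(f, f^d)` column of the same two tables, rows `R = I₀` (good) AND `R = I_{n>0}` (multiplicative):
`v(d) = 0`, `d ≡ 3 mod 4`: `I₀ ↦ I₄*` or `II*`, `(f, f^d) = (0, 4)` [p0015 L35–L46]; `I_{n>0} ↦ I*_{n+4}`,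
`(f, f^d) = (1, 4)` [p0015 L47–L59]; `v(d) = 1`: `I₀ ↦ I₈*` or `II`, `(f, f^d) = (0, 6)` [p0016 L124–L133];
`I_{n>0} ↦ I*_{n+8}`, `(f, f^d) = (1, 6)` [p0016 L135–L150]. So for `E/ℚ₂` with `f(E) ≤ 1` and a twist
RAMIFIED at `2`, `f(E^d) = 4` (`v(d) = 0`, `d ≡ 3 mod 4`) resp. `6` (`v(d) = 1`) — the representation-theoretic
form is F. Diamond, K. Kramer (appendix in Cornell–Silverman–Stevens 1997, p. 580): "`f(E^ψ) ≤ max{f(E), 2 f(ψ)}`,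
with equality if `f(E) ≠ 2 f(ψ)`" (here `f(E) ≤ 1 < 2 f(χ_d) ∈ {4, 6}`). The source computes `f` by Ogg's formula
(§2, p0005 L51: "From Ogg's formula we obtain the conductor exponent"), which is the tree's
`WeierstrassCurve.conductorExponent` (Silverman ATAEC IV.10–11). In the tree already: the GOOD case at `d = −1`
(`conductorNorm_quadraticTwist_neg_one`, `16 N`) and at `d = ±2` (`rootNumber_quadraticTwist_two / _neg_two`,
`64 N`); NEW here: the MULTIPLICATIVE case (`2 ∥ N`, Tate curve twisted by a ramified quadratic character).
Consumer: cell `pub/bsd-f2-manin`, line `dyadic-twist` of crux C2 `ManinOddAtFour` (stmt-BirchSwinnertonDyer-22967),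
stub `stub_dyadicTwistConductor` (`W ~ W′ ⊗ χ_d`, `d ∈ {−1, ±2}`, `W′` semistable at `2` ⟹ `N(W′) ∣ N(W)` and
`(4|d|)² ∣ N(W)`; the prime-to-`2` part is `conductorExponent_twistModel`), as located by the cell's literature
refuter (REFUTER-ref2 findings 56–57). -/

/-- **Barrios–Roy–Sahajpal–Tallana–Tobin–Wiersema 2025, Thm. 5.1, rows `R = I₀` and `R = I_{n>0}`, column
`(f, f^d)`** (Res. Number Theory 11 (2025), no. 3; arXiv:2501.03209 pp. 15–16): for `E/ℚ₂` with good or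
multiplicative reduction (`f(E) ∈ {0, 1}`), the quadratic twist `E^d` has conductor exponent `f(E^d) = 4` if
`v(d) = 0`, `d ≡ 3 (mod 4)` (types `I₄*`/`II*` from `I₀`, `I*_{n+4}` from `I_n`), and `f(E^d) = 6` if `v(d) = 1`
(types `I₈*`/`II` from `I₀`, `I*_{n+8}` from `I_n`); equivalently `f(E^ψ) = max{f(E), 2f(ψ)} = 2f(ψ)`
(Diamond–Kramer, CSS 1997 p. 580, since `f(E) ≠ 2f(ψ)`). TYPED READING: for `W/ℚ` elliptic, `v` the place of
`ℤ` above `2` (`natGenerator v = 2`) with `W.conductorExponent v ≤ 1`, and `d : ℤ`: `d ≡ 3 (mod 4)` ⟹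
`(W.quadraticTwist d).conductorExponent v = 4`, and `d ≡ 2 (mod 4)` (i.e. `v₂(d) = 1`) ⟹ `= 6`
(`conductorExponent` = Ogg's formula on the minimal model, as in the source; the tree's `quadraticTwist d` is the
paper's model (5.1) rescaled by `u = 1/2`, and the twist depends on `d` modulo squares). Weaker than the source
(no Kodaira types, discriminants or Tamagawa numbers). A named fact (`Prop`, nothing asserted; no `_holds`).
[cite: BarriosEtAl2025, Thm. 5.1, Tables tab:localdata-dodd / tab:localdata-deven, rows R = I₀ and R = I_{n>0}, column (f, f^d) (arXiv:2501.03209 pp. 15–16)]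
[cite: DiamondKramer1995, appendix in Cornell–Silverman–Stevens 1997, p. 580]
[cite: Silverman1994, IV.10–IV.11 (Ogg's formula)] -/
def conductorExponent_quadraticTwist_two_of_le_one : Prop :=
  ∀ (W : WeierstrassCurve ℚ) [W.IsElliptic] (v : IsDedekindDomain.HeightOneSpectrum ℤ),
    Rat.HeightOneSpectrum.natGenerator v = 2 → W.conductorExponent v ≤ 1 → ∀ d : ℤ,
      (d % 4 = 3 → (W.quadraticTwist (d : ℚ)).conductorExponent v = 4) ∧
      (d % 4 = 2 → (W.quadraticTwist (d : ℚ)).conductorExponent v = 6)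

end Literature.NumberTheory.EllipticCurves.BarriosEtAl2025
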